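import Literature.Topology.FourManifolds.HomotopySpheresGroupAssembly
import HarnessLib

/-!
# The group `Θₙ`: uniqueness of the connected sum on classes (discharge of `isMul_unique`)

Sibling proofs file of `HomotopySpheres.lean`. It discharges the named fact
`Literature.Topology.FourManifolds.HomotopySphereClass.isMul_unique` — "the class of an oriented
connected sum of homotopy `n`-spheres depends only on the classes of the summands"
(Kervaire–Milnor, *Groups of homotopy spheres I*, Ann. of Math. 77 (1963), §2, Lemma 2.1, p. 505:
"The connected sum operation is well defined, associative, and commutative up to orientation
preserving diffeomorphism", proved there from the disc lemma of Palais and Cerf) — as the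
theorem `Literature.Topology.FourManifolds.HomotopySphereClass.isMul_unique_holds`, in every
dimension `n`, without changing any statement of `HomotopySpheres.lean`:

* `n ≠ 0`: homotopy `n`-spheres are connected, and the tree already reduces the fact to the
  Palais–Cerf uniqueness of oriented connected sums of connected oriented manifolds
  (`HomotopySphereClass.isMul_unique_of`, `HomotopySpheresGroupProofs.lean`), which is the
  theorem `HomotopySphere.exists_diffeomorph_isOrientationPreserving_of_isOrientedConnectedSum`
  (`HomotopySpheresGroupAssembly.lean`, from the oriented disc theorem of
  `OrientedConnectedSumUniqueness.lean`; Kervaire–Milnor's printed proof).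
* `n = 0` (outside the letter of the source, whose summands are *connected*; proved here
  directly, `HomotopySphere.isOrientedDiffeomorphic_of_isOrientedConnectedSum_zero`): a homotopy
  `0`-sphere has exactly two points (`HomotopySphere.nonempty_unique_compl_singleton_zero`),
  Kervaire–Milnor's gluing relation is empty (there are no unit vectors in `ℝ⁰`), and every
  differential has determinant `1`, so that orientation conditions are pointwise equalities of
  orientation values (`isOrientationPreserving_iff_of_dim_zero`). Hence an oriented connected
  sum `U` of `(S, T)` along discs centred at `p ∈ S`, `q ∈ T` (where `oS p = o₀`, `oT q = -o₀`)
  is the two-point manifold `(S ∖ {p}) ⊔ (T ∖ {q})` with the inherited orientation values; a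
  second sum `U'` uses `o₀' = ±o₀`, and in either case the two orientation values of `U'` are
  those of `U` (up to order), so a value-matching bijection — a diffeomorphism, `0`-manifolds
  being discrete — is an orientation-preserving diffeomorphism `U ≅ U'`
  (`exists_diffeomorph_isOrientationPreserving_of_two_points`).

## References

* M. Kervaire, J. Milnor, *Groups of homotopy spheres I*, Ann. of Math. (2) 77 (1963), 504–537,
  §2, Lemma 2.1 (p. 505). doi:10.2307/1970128 [KervaireMilnorAnnals1963]
-/

open scoped Manifold ContDiff Topology ContinuousMap
open Set Module

noncomputable section

namespace Literature.Topology.FourManifolds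

/-! ### Dimension `0`: orientation conditions are pointwise equalities -/

section DimZero

/-- Every linear endomorphism of `ℝ⁰` has determinant `1 > 0` (the determinant of the empty
matrix). [folklore] -/
theorem det_pos_of_euclideanSpace_fin_zero
    (f : EuclideanSpace ℝ (Fin 0) →ₗ[ℝ] EuclideanSpace ℝ (Fin 0)) : 0 < LinearMap.det f := by
  rw [LinearMap.det_eq_one_of_finrank_eq_zero finrank_euclideanSpace_fin f]
  exact one_pos

variable {HM HN : Type*} [TopologicalSpace HM] [TopologicalSpace HN]
  {IM : ModelWithCorners ℝ (EuclideanSpace ℝ (Fin 0)) HM}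
  {IN : ModelWithCorners ℝ (EuclideanSpace ℝ (Fin 0)) HN}
  {M N : Type*} [TopologicalSpace M] [ChartedSpace HM M] [IsManifold IM 1 M]
  [TopologicalSpace N] [ChartedSpace HN N] [IsManifold IN 1 N]

/-- **In dimension `0`, a map preserves the orientations `oM`, `oN` iff `oN (f x) = oM x` at every
point**: all differentials are endomorphisms of `ℝ⁰`, of determinant `1 > 0`
(`Literature.Topology.FourManifolds.IsOrientationPreserving` compares `oN (f x) = oM x` with
positivity of this determinant). [folklore] -/
theorem isOrientationPreserving_iff_of_dim_zero (oM : SmoothOrientation IM M)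
    (oN : SmoothOrientation IN N) (f : M → N) :
    IsOrientationPreserving oM oN f ↔ ∀ x, oN (f x) = oM x :=
  forall_congr' fun _ => iff_true_right (det_pos_of_euclideanSpace_fin_zero _)

end DimZero

/-! ### Dimension `0`: two-point oriented `0`-manifolds -/

section TwoPoints

variable {X Y : Type*} [TopologicalSpace X] [ChartedSpace (EuclideanSpace ℝ (Fin 0)) X]
  [IsManifold (𝓡 0) ∞ X] [TopologicalSpace Y] [ChartedSpace (EuclideanSpace ℝ (Fin 0)) Y]
  [IsManifold (𝓡 0) ∞ Y]

omit [IsManifold (𝓡 0) ∞ X] [IsManifold (𝓡 0) ∞ Y] in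
/-- **Every bijection of `0`-manifolds is a diffeomorphism**: manifolds modelled on `ℝ⁰` are
discrete (`Literature.Topology.FourManifolds.discreteTopology_of_chartedSpace_fin_zero`), and
every map out of a discrete manifold is smooth (Mathlib's `contMDiff_of_discreteTopology`).
[folklore] -/
theorem exists_diffeomorph_apply_eq_of_dim_zero (e : X ≃ Y) :
    ∃ φ : X ≃ₘ⟮𝓡 0, 𝓡 0⟯ Y, ∀ x, φ x = e x := by
  haveI := discreteTopology_of_chartedSpace_fin_zero X
  haveI := discreteTopology_of_chartedSpace_fin_zero Y
  exact ⟨{ toEquiv := e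
           contMDiff_toFun := contMDiff_of_discreteTopology
           contMDiff_invFun := contMDiff_of_discreteTopology }, fun _ => rfl⟩

/-- **Oriented two-point `0`-manifolds with the same orientation values are
oriented-diffeomorphic.** If `X = {x₁, x₂}` and `Y = {y₁, y₂}` (two points each) carry
orientations with `oY y₁ = oX x₁` and `oY y₂ = oX x₂`, the bijection `x₁ ↦ y₁, x₂ ↦ y₂` is
an orientation-preserving diffeomorphism (`exists_diffeomorph_apply_eq_of_dim_zero`,
`isOrientationPreserving_iff_of_dim_zero`). [folklore] -/
theorem exists_diffeomorph_isOrientationPreserving_of_two_points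
    {oX : SmoothOrientation (𝓡 0) X} {oY : SmoothOrientation (𝓡 0) Y} {x₁ x₂ : X}
    {y₁ y₂ : Y} (hx : x₁ ≠ x₂) (hy : y₁ ≠ y₂) (hX : ∀ x, x = x₁ ∨ x = x₂)
    (hY : ∀ y, y = y₁ ∨ y = y₂)
    (h₁ : oY y₁ = oX x₁) (h₂ : oY y₂ = oX x₂) :
    ∃ φ : X ≃ₘ⟮𝓡 0, 𝓡 0⟯ Y, φ.IsOrientationPreserving oX oY := by
  classical
  let e : X ≃ Y :=
    { toFun := fun x => if x = x₁ then y₁ else y₂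
      invFun := fun y => if y = y₁ then x₁ else x₂
      left_inv := fun x => by
        rcases hX x with rfl | rfl
        · simp
        · simp [hx.symm, hy.symm]
      right_inv := fun y => by
        rcases hY y with rfl | rfl
        · simp
        · simp [hx.symm, hy.symm] }
  obtain ⟨φ, hφ⟩ := exists_diffeomorph_apply_eq_of_dim_zero e
  refine ⟨φ, (isOrientationPreserving_iff_of_dim_zero oX oY φ).2 fun x => ?_⟩
  rw [hφ x]
  rcases hX x with rfl | rfl
  · simpa [e] using h₁
  · simpa [e, hx.symm] using h₂

end TwoPoints

/-! ### Dimension `0`: oriented connected sums of homotopy `0`-spheres -/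

namespace HomotopySphere

/-- A homotopy `0`-sphere has exactly two points: two points different from `p` coincide
(`nonempty_unique_compl_singleton_zero`). [folklore] -/
theorem eq_of_ne_of_ne_zero (S : HomotopySphere 0) {p a b : S.carrier} (ha : a ≠ p)
    (hb : b ≠ p) : a = b := by
  obtain ⟨hU⟩ := S.nonempty_unique_compl_singleton_zero p
  have h := Subsingleton.elim
    (⟨a, mem_compl_singleton_iff.2 ha⟩ : ↥(({p}ᶜ : Set S.carrier)))
    ⟨b, mem_compl_singleton_iff.2 hb⟩
  exact congrArg Subtype.val h

/-- A homotopy `0`-sphere has exactly two points: there is a point different from `p`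
(`nonempty_unique_compl_singleton_zero`). [folklore] -/
theorem exists_ne_zero (S : HomotopySphere 0) (p : S.carrier) : ∃ a : S.carrier, a ≠ p := by
  obtain ⟨hU⟩ := S.nonempty_unique_compl_singleton_zero p
  exact ⟨((default : ↥(({p}ᶜ : Set S.carrier))) : S.carrier),
    mem_compl_singleton_iff.1 (default : ↥(({p}ᶜ : Set S.carrier))).2⟩

/-- In a homotopy `0`-sphere, if two centres `p`, `p'` carry the same orientation value then the
points opposite to them carry the same orientation value (either `p = p'` and the opposite
points coincide, or `{p, p'}` is the whole sphere and the opposite points are `p'`, `p`).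
[folklore] -/
theorem orientation_eq_of_ne_of_ne_zero (S : HomotopySphere 0) {p p' a a' : S.carrier}
    (hp : S.orientation p = S.orientation p') (ha : a ≠ p) (ha' : a' ≠ p') :
    S.orientation a = S.orientation a' := by
  by_cases hpp : p' = p
  · subst hpp
    rw [S.eq_of_ne_of_ne_zero ha ha']
  · rw [S.eq_of_ne_of_ne_zero ha hpp, ← S.eq_of_ne_of_ne_zero (Ne.symm hpp) ha', hp]

/-- In a homotopy `0`-sphere, if two centres `p`, `p'` carry different orientation values then
the point opposite to `p` is `p'`. [folklore] -/
theorem eq_of_orientation_ne_zero (S : HomotopySphere 0) {p p' a : S.carrier}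
    (hp : S.orientation p ≠ S.orientation p') (ha : a ≠ p) : a = p' :=
  S.eq_of_ne_of_ne_zero ha fun h => hp (h ▸ rfl)

/-- **The shape of an oriented connected sum of homotopy `0`-spheres.** If `(U, oU)` is an
oriented connected sum of the homotopy `0`-spheres `(S, oS)`, `(T, oT)`, then for some
orientation `o₀` of `ℝ⁰` and centres `p ∈ S`, `q ∈ T` with `oS p = o₀`, `oT q = -o₀`
(the centres of the orientation-preserving, resp. reversing, discs), `U` consists of exactly
two points `x₁ ≠ x₂`, images of the points of `S ∖ {p}` and `T ∖ {q}`, carrying their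
orientation values: Kervaire–Milnor's gluing relation is empty in dimension `0` (no unit
vectors), and all
orientation conditions are pointwise (`isOrientationPreserving_iff_of_dim_zero`).
(Kervaire–Milnor 1963, §2, construction of `M₁ # M₂`, read in dimension `0`.)
[cite: KervaireMilnorAnnals1963, §2 (p. 505)] -/
theorem exists_two_points_of_isOrientedConnectedSum_zero (S T U : HomotopySphere 0)
    (h : IsOrientedConnectedSum S.orientation T.orientation U.orientation) :
    ∃ (o₀ : Orientation ℝ (EuclideanSpace ℝ (Fin 0)) (Fin (finrank ℝ (EuclideanSpace ℝ (Fin 0)))))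
      (p : S.carrier) (q : T.carrier) (x₁ x₂ : U.carrier),
      S.orientation p = o₀ ∧ T.orientation q = -o₀ ∧ x₁ ≠ x₂ ∧ (∀ x, x = x₁ ∨ x = x₂) ∧
      (∀ a, a ≠ p → U.orientation x₁ = S.orientation a) ∧
      ∀ b, b ≠ q → U.orientation x₂ = T.orientation b := by
  obtain ⟨i₁, i₂, o₀, jA, jB, -, -, ho₁, ho₂, ⟨-, -, -, -, hcov, hR⟩, hjA, hjB⟩ := h
  -- the points of the punctured pieces
  obtain ⟨a₀, ha₀⟩ := S.exists_ne_zero (i₁ 0)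
  obtain ⟨b₀, hb₀⟩ := T.exists_ne_zero (i₂ 0)
  let a : ↥(puncture i₁) := ⟨a₀, mem_puncture.2 ha₀⟩
  let b : ↥(puncture i₂) := ⟨b₀, mem_puncture.2 hb₀⟩
  have hau : ∀ x : ↥(puncture i₁), x = a := fun x =>
    Subtype.ext (S.eq_of_ne_of_ne_zero (mem_puncture.1 x.2) ha₀)
  have hbu : ∀ y : ↥(puncture i₂), y = b := fun y =>
    Subtype.ext (T.eq_of_ne_of_ne_zero (mem_puncture.1 y.2) hb₀)
  -- the gluing relation is empty
  have hrel : ∀ x y, ¬ connectedSumRel i₁ i₂ x y := by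
    rintro x y ⟨u, t, hu, -⟩
    rw [Subsingleton.elim u 0, norm_zero] at hu
    exact zero_ne_one hu
  refine ⟨o₀, i₁ 0, i₂ 0, jA a, jB b, ?_, ?_, fun hab => hrel a b ((hR a b).1 hab),
    fun x => ?_, fun a' ha' => ?_, fun b' hb' => ?_⟩
  · exact ((isOrientationPreserving_iff_of_dim_zero _ _ _).1 ho₁ 0).trans
      (SmoothOrientation.modelSpace_apply o₀ 0)
  · have h2 := (isOrientationPreserving_iff_of_dim_zero _ _ _).1 ho₂ 0
    rw [SmoothOrientation.neg_apply, SmoothOrientation.modelSpace_apply] at h2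
    exact (neg_eq_iff_eq_neg (a := T.orientation (i₂ 0)) (b := o₀)).1 h2
  · rcases (eq_univ_iff_forall.1 hcov x) with ⟨x', rfl⟩ | ⟨y', rfl⟩
    · exact Or.inl (by rw [hau x'])
    · exact Or.inr (by rw [hbu y'])
  · rw [(isOrientationPreserving_iff_of_dim_zero _ _ _).1 hjA a,
      SmoothOrientation.restrict_apply, S.eq_of_ne_of_ne_zero ha' ha₀]
  · rw [(isOrientationPreserving_iff_of_dim_zero _ _ _).1 hjB b,
      SmoothOrientation.restrict_apply, T.eq_of_ne_of_ne_zero hb' hb₀]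

/-- **Uniqueness of oriented connected sums of homotopy `0`-spheres** (the case of
Kervaire–Milnor's Lemma 2.1 "well defined … up to orientation preserving diffeomorphism" left
out by its hypothesis that the summands be connected; Kervaire–Milnor 1963, §2, p. 505): two
oriented connected sums `U`, `U'` of the same oriented homotopy `0`-spheres `S`, `T` are
oriented-diffeomorphic. By `exists_two_points_of_isOrientedConnectedSum_zero`, `U` is
`(S ∖ {p}) ⊔ (T ∖ {q})` with `oS p = o₀`, `oT q = -o₀`, and `U'` likewise with
`o₀' = ±o₀` (`Orientation.eq_or_eq_neg`); if `o₀' = o₀` the pieces of `U'` carry the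
orientation values of
the corresponding pieces of `U`, and if `o₀' = -o₀` those of the opposite pieces; in both cases
`exists_diffeomorph_isOrientationPreserving_of_two_points` applies.
[cite: KervaireMilnorAnnals1963, Lemma 2.1 (p. 505)] -/
theorem isOrientedDiffeomorphic_of_isOrientedConnectedSum_zero (S T U U' : HomotopySphere 0)
    (h : IsOrientedConnectedSum S.orientation T.orientation U.orientation)
    (h' : IsOrientedConnectedSum S.orientation T.orientation U'.orientation) :
    U.IsOrientedDiffeomorphic U' := by
  obtain ⟨o₀, p, q, x₁, x₂, hp, hq, hx, hX, hx₁, hx₂⟩ :=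
    exists_two_points_of_isOrientedConnectedSum_zero S T U h
  obtain ⟨o₀', p', q', y₁, y₂, hp', hq', hy, hY, hy₁, hy₂⟩ :=
    exists_two_points_of_isOrientedConnectedSum_zero S T U' h'
  obtain ⟨a, ha⟩ := S.exists_ne_zero p
  obtain ⟨b, hb⟩ := T.exists_ne_zero q
  obtain ⟨a', ha'⟩ := S.exists_ne_zero p'
  obtain ⟨b', hb'⟩ := T.exists_ne_zero q'
  have ho₀ : o₀ ≠ -o₀ := Module.Ray.ne_neg_self o₀
  rcases Orientation.eq_or_eq_neg o₀' o₀ (Fintype.card_fin _) with rfl | rfl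
  · -- same disc orientation: match the `S`-pieces and the `T`-pieces
    have hS : S.orientation a = S.orientation a' :=
      S.orientation_eq_of_ne_of_ne_zero (hp.trans hp'.symm) ha ha'
    have hT : T.orientation b = T.orientation b' :=
      T.orientation_eq_of_ne_of_ne_zero (hq.trans hq'.symm) hb hb'
    exact exists_diffeomorph_isOrientationPreserving_of_two_points hx hy hX hY
      (by rw [hy₁ a' ha', hx₁ a ha, hS]) (by rw [hy₂ b' hb', hx₂ b hb, hT])
  · -- opposite disc orientations: match the `S`-piece of `U` with the `T`-piece of `U'`
    have hpp' : S.orientation p ≠ S.orientation p' := by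
      rw [hp, hp']; exact ho₀
    have hqq' : T.orientation q ≠ T.orientation q' := by
      rw [hq, hq']
      exact fun h => ho₀ ((_root_.neg_neg o₀).symm.trans h.symm)
    have hSa : S.orientation a = -o₀ := by rw [S.eq_of_orientation_ne_zero hpp' ha, hp']
    have hSa' : S.orientation a' = o₀ := by rw [S.eq_of_orientation_ne_zero hpp'.symm ha', hp]
    have hTb : T.orientation b = o₀ := by
      rw [T.eq_of_orientation_ne_zero hqq' hb, hq']
      exact _root_.neg_neg o₀
    have hTb' : T.orientation b' = -o₀ := by rw [T.eq_of_orientation_ne_zero hqq'.symm hb', hq]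
    exact exists_diffeomorph_isOrientationPreserving_of_two_points hx hy.symm hX
      (fun y => (hY y).symm) (by rw [hy₂ b' hb', hx₁ a ha, hSa, hTb'])
      (by rw [hy₁ a' ha', hx₂ b hb, hTb, hSa'])

end HomotopySphere

/-! ### The discharge -/

namespace HomotopySphereClass

variable {n : ℕ}

/-- **`isMul_unique` in dimension `0`** (proved at manifold level by
`HomotopySphere.isOrientedDiffeomorphic_of_isOrientedConnectedSum_zero`, after transporting the
second witness to the representatives of the first,
`IsMul.exists_isOrientedConnectedSum_of_mk_eq`).
[cite: KervaireMilnorAnnals1963, Lemma 2.1 (p. 505)] -/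
theorem isMul_unique_zero : isMul_unique (n := 0) := by
  intro a b c c' h h'
  obtain ⟨S, T, U, rfl, rfl, rfl, hU⟩ := h
  obtain ⟨U', hc', hU'⟩ := h'.exists_isOrientedConnectedSum_of_mk_eq rfl rfl
  rw [← hc']
  exact sound
    (HomotopySphere.isOrientedDiffeomorphic_of_isOrientedConnectedSum_zero S T U U' hU hU')

/-- **Kervaire–Milnor's Lemma 2.1, "well defined", on `Θₙ` — the named fact
`HomotopySphereClass.isMul_unique` holds in every dimension**: the class of an oriented connected
sum of homotopy `n`-spheres depends only on the classes of the summands (Kervaire–Milnor,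
*Groups of homotopy spheres I* (1963), §2, Lemma 2.1, p. 505: "The connected sum operation is well
defined … up to orientation preserving diffeomorphism", from the disc lemma of Palais and Cerf).
For `n ≠ 0` this is `isMul_unique_of` fed with the theorem
`HomotopySphere.exists_diffeomorph_isOrientationPreserving_of_isOrientedConnectedSum` (the
Palais–Cerf uniqueness of oriented connected sums of the connected carriers, proved in
`OrientedConnectedSumUniqueness.lean`); for `n = 0` (two-point spheres, not connected) it is
`isMul_unique_zero`. [cite: KervaireMilnorAnnals1963, Lemma 2.1 (p. 505)] -/
theorem isMul_unique_holds : isMul_unique (n := n) := by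
  rcases eq_or_ne n 0 with rfl | hn
  · exact isMul_unique_zero
  · exact isMul_unique_of hn
      HomotopySphere.exists_diffeomorph_isOrientationPreserving_of_isOrientedConnectedSum

end HomotopySphereClass

end Literature.Topology.FourManifolds
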